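import Literature.NumberTheory.GaloisCohomology.CyclotomicKillingPrimePower
import Literature.NumberTheory.GaloisRepresentations.ModNCyclotomicCharacter
import HarnessLib

/-!
# `p`-power-torsion Brauer classes of a number field die on a layer `Gal(K̄/K_M)` of the
# cyclotomic `ℤ_p`-tower (Serre, *Cohomologie galoisienne* II §4.4 Prop. 13 and I §3.3 Prop. 14;
# Tate, Cassels–Fröhlich VII §10: every class of `Br(K)` is split by a cyclic cyclotomic extension)

Topic `NumberTheory/GaloisCohomology`; namespace `Literature.NumberTheory.GaloisCohomology`.
Proof file (theorems only; no definition, no named fact, no instance; D-0026) — node N-k of the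
(F1) campaign of cell `bsd-cn100` (Poitou–Tate for THE family `LocalInvariants.canonical`),
second part: the killing field is brought down from `K(μ_p)·K_M`
(`CyclotomicKillingPrimePower.lean`) to the CYCLIC layer `K_M` itself.

* `nsmul_two_eq_zero_of_forall` — `n · H²(G, X) = 0` if `n · X = 0` (cocycles with values in an
  `n`-torsion module), the `H²` companion of the tree's `galoisCohomology.nsmul_eq_zero_of_forall`;
* `galFixing_adjoin_primitiveRoot_eq_ker` — for a primitive `p`-th root of unity `ζ ∈ K̄`,
  `Gal(K̄/K(ζ)) = ker χ̄_p` (`χ̄_p = modNCyclotomicCharacter K p` the mod-`p` cyclotomic character),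
  and `index_ker_modNCyclotomicCharacter_coprime` — its index divides `p − 1`, so is prime to `p`;
* `exists_resH_layerSubgroup_mu_primePow_eq_zero` — **MAIN**: for a number field `K` with
  `p ≠ 2` or `K` totally complex, `κ` its cyclotomic `ℤ_p`-extension and ANY class
  `c ∈ H²(Γ_K, μ_{p^m})`, there is `M` with `res c = 0` in `H²(Gal(K̄/K_M), μ_{p^m})`,
  `Gal(K̄/K_M) = κ.layerSubgroup M` — from the killing on `Gal(K̄/K(μ_p)·K_M)`
  (`exists_forall_resSub_mu_primePow_eq_zero_of_le_layerSubgroup`) and the injectivity of `Res`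
  on `p`-primary classes for the open subgroup `Gal(K̄/K(μ_p)K_M) ≤ Gal(K̄/K_M)` of index dividing
  `p − 1` (the tree's `eq_zero_of_resH_eq_zero_of_psmul_eq_zero`, Serre I §3.3 Prop. 14:
  `cor ∘ res = index`); `…_kummer_eq_zero`: the same for the Kummer image in `H²(·, K̄ˣ)` —
  **every `p`-power-torsion Brauer class of `K` is split by some layer `K_M/K` of the cyclotomic
  `ℤ_p`-extension, a CYCLIC extension of degree `p^M` unramified outside `p`** (no support
  hypothesis, no `μ_p ⊂ K`).

HONEST FRAMING: textbook Galois cohomology; infrastructure for Poitou–Tate; proves no case of BSD.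

## References

* J.-P. Serre, *Cohomologie galoisienne* / *Galois Cohomology* (1997), II §4.4 Prop. 13,
  I §3.3 Prop. 14 (Res injective on `p`-primary components for index prime to `p`).
  [SerreGaloisCohomology1997]
* J. Tate, *Global class field theory*, Ch. VII of Cassels–Fröhlich (1967), §10.
  [CasselsFrohlichANT1967]
-/

noncomputable section

open CategoryTheory Function
open Field IntermediateField NumberField IsDedekindDomain

universe u

namespace Literature.NumberTheory.GaloisCohomology

open _root_.TopRep _root_.ContRepresentation _root_.ContinuousCohomology
open Literature.NumberTheory.GaloisRepresentations
open Literature.NumberTheory.GaloisRepresentations.DiscreteGaloisModule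
open Literature.NumberTheory.GaloisRepresentations.LocalWeilDatum
open Literature.NumberTheory.EllipticCurves (ZpExtension)
open scoped IntermediateField

/-! ### §1. `H²` with values in an `n`-torsion module is `n`-torsion -/

section Torsion

variable {R : Type u} [CommRing R] [TopologicalSpace R]
variable {G : Type u} [Group G] [TopologicalSpace G] [IsTopologicalGroup G] [LocallyCompactSpace G]

/-- **`n · H²(G, X) = 0` if `n · X = 0`**: every class is the class of a continuous `2`-cocycle
(`twoCocycleClass_surjective`), which is killed by `n` pointwise.
[cite: SerreGaloisCohomology1997, I §2.2] -/
theorem nsmul_two_eq_zero_of_forall (X : TopRep.{u} R G) {n : ℕ} (hX : ∀ x : X, n • x = 0)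
    (c : continuousCohomology 2 X) : n • c = 0 := by
  obtain ⟨f, rfl⟩ := twoCocycleClass_surjective X c
  have hf : (n : R) • f = 0 := by
    refine Subtype.ext (ContinuousMap.ext fun q => ?_)
    change (n : R) • f.1 q = 0
    rw [Nat.cast_smul_eq_nsmul]
    exact hX _
  rw [← Nat.cast_smul_eq_nsmul R, ← twoCocycleClass_smul, hf, twoCocycleClass_zero]

end Torsion

/-! ### §2. `Gal(K̄/K(ζ_p))` is the kernel of the mod-`p` cyclotomic character; its index is prime to `p` -/

section ModP

variable (K : Type) [Field K] {p : ℕ} [hp : Fact p.Prime] [NeZero (p : K)]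

/-- **`Gal(K̄/K(ζ)) = ker χ̄_p`** for a primitive `p`-th root of unity `ζ ∈ K̄`: an automorphism fixes
`K(ζ)` iff it fixes `ζ` iff its mod-`p` cyclotomic character is `1`
(`modNCyclotomicCharacter_eq_one_of_mem_fixingSubgroup`, `modNCyclotomicCharacter_spec`).
[cite: SerreGaloisCohomology1997, II §4.4 (proof of Prop. 13: passage to `K(μ_p)`)] -/
theorem galFixing_adjoin_primitiveRoot_eq_ker {ζ : AlgebraicClosure K} (hζ : IsPrimitiveRoot ζ p) :
    galFixing K K⟮ζ⟯ = (modNCyclotomicCharacter K p).ker := by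
  ext σ
  rw [mem_galFixing_iff, MonoidHom.mem_ker]
  constructor
  · intro h
    exact modNCyclotomicCharacter_eq_one_of_mem_fixingSubgroup K p hζ σ
      ((IntermediateField.mem_fixingSubgroup_iff _ _).2 fun x hx => h x hx)
  · intro h x hx
    have hζfix : σ • ζ = ζ := by
      rw [modNCyclotomicCharacter_spec K p σ ζ hζ.pow_eq_one, h, Units.val_one, ZMod.val_one, pow_one]
    exact smul_eq_self_of_mem_adjoin K (S := {ζ}) (fun y hy => by rw [Set.mem_singleton_iff.1 hy]; exact hζfix) hx

omit hp [NeZero (p : K)] in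
/-- `K(ζ)/K` is finite for `ζ ∈ K̄` (an algebraic element generates a finite extension). [folklore] -/
private theorem finiteDimensional_adjoin_algebraicClosure (ζ : AlgebraicClosure K) :
    FiniteDimensional K K⟮ζ⟯ :=
  IntermediateField.adjoin.finiteDimensional (Algebra.IsIntegral.isIntegral ζ)

/-- `Gal(K̄/K(ζ))` fixes every `p`-th root of unity (they are powers of the primitive root `ζ`).
[cite: SerreGaloisCohomology1997, II §4.4] -/
theorem galFixing_adjoin_smul_rootsOfUnity {ζ : AlgebraicClosure K} (hζ : IsPrimitiveRoot ζ p)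
    (σ : absoluteGaloisGroup K) (hσ : σ ∈ galFixing K K⟮ζ⟯)
    (ξ : rootsOfUnity p (AlgebraicClosure K)) : σ • (ξ : (AlgebraicClosure K)ˣ) = ξ := by
  rw [galFixing_adjoin_primitiveRoot_eq_ker K hζ, MonoidHom.mem_ker] at hσ
  have hξ : ((ξ : (AlgebraicClosure K)ˣ) : AlgebraicClosure K) ^ p = 1 := by
    have h := ξ.2
    rw [mem_rootsOfUnity] at h
    have h' := congrArg (fun u : (AlgebraicClosure K)ˣ => (u : AlgebraicClosure K)) h
    simpa only [Units.val_pow_eq_pow_val, Units.val_one] using h'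
  refine Units.ext ?_
  rw [Units.coe_smul, modNCyclotomicCharacter_spec K p σ _ hξ, hσ, Units.val_one, ZMod.val_one, pow_one]

/-- **The index of `ker χ̄_p = Gal(K̄/K(μ_p))` in `Γ_K` is prime to `p`**: it is the order of the image
of `χ̄_p` in `(ℤ/p)ˣ`, which divides `p − 1`. [cite: SerreGaloisCohomology1997, II §4.4 (proof of Prop. 13)] -/
theorem index_ker_modNCyclotomicCharacter_coprime :
    ((modNCyclotomicCharacter K p).ker).index.Coprime p := by
  have hpp := hp.out
  rw [Subgroup.index_ker]
  have hdvd : Nat.card (modNCyclotomicCharacter K p).range ∣ p - 1 := by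
    have h1 : Nat.card (modNCyclotomicCharacter K p).range ∣ Nat.card (ZMod p)ˣ :=
      Subgroup.card_subgroup_dvd_card _
    have h2 : Nat.card (ZMod p)ˣ = p - 1 := by
      rw [Nat.card_eq_fintype_card, ZMod.card_units_eq_totient, Nat.totient_prime hpp]
    rwa [h2] at h1
  have hpos : 0 < Nat.card (modNCyclotomicCharacter K p).range := Nat.card_pos
  refine (Nat.Prime.coprime_iff_not_dvd hpp).2 (fun h => ?_) |>.symm
  have hle : Nat.card (modNCyclotomicCharacter K p).range ≤ p - 1 :=
    Nat.le_of_dvd (Nat.sub_pos_of_lt hpp.one_lt) hdvd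
  have hle' := Nat.le_of_dvd hpos h
  omega

end ModP

/-! ### §3. Killing on the cyclic layer `Gal(K̄/K_M)` -/

section Layer

variable (K : Type) [Field K] [NumberField K] {p : ℕ} [hp : Fact p.Prime]

attribute [local instance] compactSpace_of_isClosed_subgroup

/-- **Every class of `H²(Γ_K, μ_{p^m})` dies on a layer `Gal(K̄/K_M)` of the cyclotomic
`ℤ_p`-extension** (`K` a number field with `p ≠ 2` or `K` totally complex, `κ` cyclotomic): there is
`M` with `res c = 0 ∈ H²(κ⁻¹(p^M ℤ_p), μ_{p^m})`.  Proof: by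
`exists_forall_resSub_mu_primePow_eq_zero_of_le_layerSubgroup` the class dies on
`Gal(K̄/K(ζ_p)) ∩ κ⁻¹(p^M ℤ_p)`, an open subgroup of `κ⁻¹(p^M ℤ_p)` of index dividing
`[K(ζ_p) : K] ∣ p − 1`; `Res` to an open subgroup of index prime to `p` is injective on `p`-primary
classes (`eq_zero_of_resH_eq_zero_of_psmul_eq_zero`, Serre I §3.3 Prop. 14), and `H²(·, μ_{p^m})` is
`p^m`-torsion. [cite: SerreGaloisCohomology1997, II §4.4 Prop. 13 and I §3.3 Prop. 14]
[cite: CasselsFrohlichANT1967, Ch. VII §10] -/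
theorem exists_resH_layerSubgroup_mu_primePow_eq_zero
    (hk : p ≠ 2 ∨ IsTotallyComplex K) {κ : ZpExtension K p} (hκ : κ.IsCyclotomic) (m : ℕ)
    (c : galoisCohomology (mu K (p ^ m)) 2) :
    ∃ M : ℕ, resH (κ.layerSubgroup M) (mu K (p ^ m)) 2 c = 0 := by
  classical
  have hpp : p.Prime := hp.out
  haveI : CompactSpace (absoluteGaloisGroup K) := absoluteGaloisGroup_compactSpace K
  haveI : NeZero ((p : ℕ) : AlgebraicClosure K) :=
    NeZero.nat_of_injective (algebraMap K (AlgebraicClosure K)).injective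
  haveI : NeZero (p : K) := ⟨Nat.cast_ne_zero.2 hpp.ne_zero⟩
  -- the field `E = K(ζ_p)` and its Galois group `H = ker χ̄_p`
  obtain ⟨ζ, hζ⟩ := HasEnoughRootsOfUnity.exists_primitiveRoot (AlgebraicClosure K) p
  haveI : FiniteDimensional K K⟮ζ⟯ := finiteDimensional_adjoin_algebraicClosure K ζ
  have hEker : galFixing K K⟮ζ⟯ = (modNCyclotomicCharacter K p).ker :=
    galFixing_adjoin_primitiveRoot_eq_ker K hζ
  -- (1) killing on `Gal(K̄/K(ζ)) ∩ κ⁻¹(p^M)`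
  obtain ⟨M, hM⟩ := exists_forall_resSub_mu_primePow_eq_zero_of_le_layerSubgroup K hk hκ m K⟮ζ⟯
    (galFixing_adjoin_smul_rootsOfUnity K hζ) (resH (galFixing K K⟮ζ⟯) (mu K (p ^ m)) 2 c)
  refine ⟨M, ?_⟩
  -- the ambient layer subgroup `S` and its open subgroup `S₁ = Gal(K̄/K(ζ)) ∩ S`
  set S : Subgroup (absoluteGaloisGroup K) := κ.layerSubgroup M with hSdef
  haveI hSc : IsClosed ((S : Subgroup (absoluteGaloisGroup K)) : Set (absoluteGaloisGroup K)) :=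
    Subgroup.isClosed_of_isOpen _ (κ.isOpen_layerSubgroup M)
  let S₁ : Subgroup S := (galFixing K K⟮ζ⟯).subgroupOf S
  have hS₁map : S₁.map S.subtype = galFixing K K⟮ζ⟯ ⊓ S := Subgroup.subgroupOf_map_subtype _ _
  have hT_E : S₁.map S.subtype ≤ galFixing K K⟮ζ⟯ := hS₁map.le.trans inf_le_left
  have hT_S : S₁.map S.subtype ≤ κ.layerSubgroup M := hS₁map.le.trans inf_le_right
  haveI hTc : IsClosed ((S₁.map S.subtype : Subgroup (absoluteGaloisGroup K)) : Set (absoluteGaloisGroup K)) := by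
    rw [hS₁map, Subgroup.coe_inf]
    exact (isClosed_galFixing K K⟮ζ⟯).inter hSc
  -- (2) the restriction of `res_S c` to `S₁` vanishes
  have hres0 : resSub (mu K (p ^ m)) (map_subtype_le' S₁) 2 (resH S (mu K (p ^ m)) 2 c) = 0 := by
    rw [← resH_eq_resSub_resH, resH_eq_resSub_resH (mu K (p ^ m)) hT_E]
    exact hM _ hT_E hT_S
  have hz : resH S₁ ((mu K (p ^ m)).restrict (subgroupIncl S)) 2 (resH S (mu K (p ^ m)) 2 c) = 0 :=
    (resSub_eq_zero_iff_resH_eq_zero (mu K (p ^ m)) S₁ 2 _).1 hres0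
  -- (3) `S₁` is open of index prime to `p`, and the class is `p^m`-torsion
  have hopen : IsOpen ((S₁ : Subgroup S) : Set S) :=
    (isOpen_galFixing K K⟮ζ⟯).preimage continuous_subtype_val
  have hcop : S₁.index.Coprime p := by
    haveI : (galFixing K K⟮ζ⟯).Normal := by rw [hEker]; infer_instance
    have hdvd : S₁.index ∣ (galFixing K K⟮ζ⟯).index :=
      Subgroup.relIndex_dvd_index_of_normal (galFixing K K⟮ζ⟯) S
    rw [hEker] at hdvd
    exact Nat.Coprime.coprime_dvd_left hdvd (index_ker_modNCyclotomicCharacter_coprime K)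
  have htors : (p ^ m) • resH S (mu K (p ^ m)) 2 c = 0 :=
    nsmul_two_eq_zero_of_forall _ (fun x => by
      change (p ^ m) • (x : MuCarrier K (p ^ m)) = 0
      rw [← natCast_zsmul]
      exact zsmul_muCarrier_eq_zero K (p ^ m) x) _
  exact eq_zero_of_resH_eq_zero_of_psmul_eq_zero ((mu K (p ^ m)).restrict (subgroupIncl S)) S₁
    hopen hcop _ hz htors

/-- **Kummer form**: the Brauer class `Kummer c ∈ H²(Γ_K, K̄ˣ)` of any `c ∈ H²(Γ_K, μ_{p^m})` is
split by some layer `K_M` of the cyclotomic `ℤ_p`-extension: `res (Kummer c) = 0` in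
`H²(Gal(K̄/K_M), K̄ˣ)` (`p ≠ 2` or `K` totally complex). [cite: CasselsFrohlichANT1967, Ch. VII §10]
[cite: SerreGaloisCohomology1997, II §4.4 Prop. 13] -/
theorem exists_resH_layerSubgroup_kummer_eq_zero
    (hk : p ≠ 2 ∨ IsTotallyComplex K) {κ : ZpExtension K p} (hκ : κ.IsCyclotomic) (m : ℕ)
    (c : galoisCohomology (mu K (p ^ m)) 2) :
    haveI : CompactSpace (absoluteGaloisGroup K) := absoluteGaloisGroup_compactSpace K
    ∃ M : ℕ, resH (κ.layerSubgroup M) (mu K (p ^ m)) 2 c = 0 ∧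
      resH (κ.layerSubgroup M) (units K) 2 (cohomologyMap (kummerι K (p ^ m)) 2 c) = 0 := by
  haveI : CompactSpace (absoluteGaloisGroup K) := absoluteGaloisGroup_compactSpace K
  obtain ⟨M, hM⟩ := exists_resH_layerSubgroup_mu_primePow_eq_zero K hk hκ m c
  refine ⟨M, hM, ?_⟩
  rw [resH_cohomologyMap_resModHom, hM, map_zero]

/-- The same with the layer named by its field: `res c = 0` in `H²(Gal(K̄/κ.layer M), μ_{p^m})`
(`galFixing K (κ.layer M) = κ.layerSubgroup M`, `galFixing_layer`). [cite: CasselsFrohlichANT1967, Ch. VII §10] -/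
theorem exists_resH_galFixing_layer_mu_primePow_eq_zero
    (hk : p ≠ 2 ∨ IsTotallyComplex K) {κ : ZpExtension K p} (hκ : κ.IsCyclotomic) (m : ℕ)
    (c : galoisCohomology (mu K (p ^ m)) 2) :
    ∃ M : ℕ, resH (galFixing K (κ.layer M)) (mu K (p ^ m)) 2 c = 0 := by
  obtain ⟨M, hM⟩ := exists_resH_layerSubgroup_mu_primePow_eq_zero K hk hκ m c
  refine ⟨M, ?_⟩
  rw [galFixing_layer]
  exact hM

end Layer

end Literature.NumberTheory.GaloisCohomology

end
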